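import Summits.CriticalPhenomena.SAWScalingLimit.Theorems.SAWTotalPositivityTPToTraversalBoundBoundaryShellsAux
import Summits.CriticalPhenomena.SAWScalingLimit.Theorems.SAWDevelopingMapHexTightExponentBootstrap
import Literature.Probability.RandomPlanarGeometry.ShellTraversalNet

/-!
# The crux `TPToTraversalBound` is per-shell tightness of the traversal number (line `radial-portal-transfer`, rev 5)

Crux `Summit.CriticalPhenomena.SAWScalingLimit.Theses.SAWTotalPositivity.TPToTraversalBound`
(stmt-CriticalPhenomena-10687) `= BoundaryTP2 → CriticalBubbleBound → SAWTraversalBound`, the conclusion being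
Aizenman–Burchard's hypothesis (H1) for the chordal critical SAW on `δℤ²` with a SHELL-DEPENDENT threshold
`k(x, ρ, R)` and constants `K, λ > 2, δ₀` depending on the Dobrushin domain and the endpoint approximation.

**Statements.**
* `ShellTightAt Ω a b` — PER-SHELL, RATE-FREE, uniform-in-mesh tightness of the traversal number: for every fixed
  shell `D(x; ρ, R)` (`0 < ρ < R ≤ 1`) and every `ε > 0` there are a threshold `k` and a mesh bound `δ₀ > 0` with
  `P_δ(the SAW polyline has k separate traversals of D(x; ρ, R)) ≤ ε` for all `δ ∈ (0, δ₀]`;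
  `ShellTight` — the same for every Dobrushin domain and endpoint approximation.
* `traversalBoundAt_of_shellTightAt` — per-shell tightness gives (H1) at `(Ω, a, b)` with EVERY exponent `λ ≥ 0`,
  constant `4^λ`, and for ALL meshes `0 < δ ≤ ρ` (no `δ₀` at all), for any bounded `Ω`;
* `shellTightAt_of_traversalBoundAt` — (H1) at `(Ω, a, b)` with SOME exponent `λ > 1` gives per-shell tightness;
* `shellTight_iff_traversalBound : ShellTight ↔ SAWTraversalBound` and
  `tpToTraversalBound_iff_shellTight : TPToTraversalBound ↔ (BoundaryTP2 → CriticalBubbleBound → ShellTight)`.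

So the power law across shells, the exponent `λ > 2` and the uniform mesh range of (H1) carry NO content for the
lattice SAW: the crux is exactly "TP₂ + the bubble ⇒ the traversal number of each fixed shell is tight as `δ → 0`".
This is the `ℤ²` twin of `HexTight.ExponentBootstrap.traversalBound_of_perShellTight` /
`perShellTight_of_traversalBound_one` (crux stmt-CriticalPhenomena-5423); it is what makes the lead's rev-5 skeleton of
the line `radial-portal-transfer` a ONE-stub skeleton (`stub_shellTight : BoundaryTP2 → CriticalBubbleBound →
ShellTight`), and it certifies that the residual stub is the crux itself in rate-free form.

**Proofs.** `→ (H1)`: fix a shell; thick shells (`R ≤ 4ρ`) are absorbed by the constant `4^λ` (`law ≤ 1`); for a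
thin shell take `ε := (ρ/R)^λ` in the hypothesis, getting `(k, δ₁)`; at fine meshes `δ ≤ δ₁` this is the bound, at
coarse meshes `δ ∈ (δ₁, ρ]` NO self-avoiding polyline of `Ω_δ` has more separate traversals than the lattice box
containing `Ω` at mesh `δ₁` has sites (`le_length_of_hasTraversals`, `length_lt_card_box`), so the threshold
`max k (#box + 1)` makes the event empty. `(H1) →`: net localization with thresholds on the middle circle
(`Curve.exists_net_hasTraversals_of_hasTraversals`, Literature/…/ShellTraversalNet): `Σ_{j<M} k(c_j, w, h-w)`
separate traversals of `D(x; ρ, R)` put `k(c_j, w, h-w)` separate traversals on the small shell `D(c_j; w, h-w)`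
about some net point (`w = 2πm/M`, `m = (ρ+R)/2`, `h = (R-ρ)/2`); at meshes `δ ≤ min(δ₀, w)` the hypothesis and
the union bound give `M · K (w/(h-w))^λ ≤ K (8πm/h)^λ M^{1-λ} → 0` (`λ > 1`), so `M = M(ε)` does it. Neither
direction uses TP₂, the bubble bound, the Jordan property or `IsEndpointApprox` (only boundedness of `Ω`).

References: M. Aizenman, A. Burchard, Duke Math. J. 99 (1999) 419–453, §1.b (1.3), Lemma 3.1; A. Kemppainen,
S. Smirnov, Ann. Probab. 45 (2017) §2 (Condition G2 — the open content of `ShellTight` for the SAW).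
-/

noncomputable section

open MeasureTheory Filter Topology Set Metric
open scoped NNReal ENNReal
open Literature.Probability.LatticeModels
open Literature.Probability.RandomPlanarGeometry
open Literature.Probability.RandomPlanarGeometry.SAW
open Summit.CriticalPhenomena.SAWScalingLimit.Theses.SAWTotalPositivity
open Summit.CriticalPhenomena.SAWScalingLimit.Theorems.TPToTraversalBound.Negative (law_apply_le_one
  law_hasTraversals_anti)

namespace Summit.CriticalPhenomena.SAWScalingLimit.Theorems.TPToTraversalBound.Radial

/-! ## Statements -/

/-- **Per-shell tightness of the traversal number at `(Ω, a, b)`.** For every fixed shell `D(x; ρ, R)` with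
`0 < ρ < R ≤ 1` and every `ε > 0` there are a threshold `k` and a mesh bound `δ₀ > 0` such that for every mesh
`δ ∈ (0, δ₀]` the critical SAW of `Ω_δ` from `a δ` to `b δ` has `k` separate traversals of the shell with
probability at most `ε`. No rate in `ρ/R`, no uniformity over shells, `k` and `δ₀` may depend on the shell
and on `ε`: the literal "the traversal number of each fixed shell is a tight family as `δ → 0`". -/
def ShellTightAt (Ω : Set ℂ) (a b : ℝ → Site 2) : Prop :=
  ∀ (x : ℂ) (ρ R : ℝ), 0 < ρ → ρ < R → R ≤ 1 → ∀ ε : ℝ, 0 < ε →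
    ∃ (k : ℕ) (δ₀ : ℝ), 0 < δ₀ ∧ ∀ δ ∈ Set.Ioc (0 : ℝ) δ₀,
      law Ω δ (a δ) (b δ) {γ | (⟨γ.walk.toCurve (meshPoint δ)⟩ : Curve ℂ).HasTraversals k x ρ R}
        ≤ ENNReal.ofReal ε

/-- **(H1) at `(Ω, a, b)` with exponent `λ`**: the body of `SAWTraversalBound` for one domain and one endpoint
family, the exponent displayed — a shell-dependent threshold `k(x, ρ, R)`, `K ≥ 0`, `δ₀ > 0` with
`P_δ(k(x,ρ,R) separate traversals of D(x; ρ, R)) ≤ K (ρ/R)^λ` for `δ ∈ (0, δ₀]`, `δ ≤ ρ < R ≤ 1`. -/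
def TraversalBoundAt (Ω : Set ℂ) (a b : ℝ → Site 2) (lam : ℝ) : Prop :=
  ∃ (k : ℂ → ℝ → ℝ → ℕ) (K δ₀ : ℝ), 0 ≤ K ∧ 0 < δ₀ ∧ ∀ δ ∈ Set.Ioc (0 : ℝ) δ₀,
    ∀ (x : ℂ) (ρ R : ℝ), δ ≤ ρ → ρ < R → R ≤ 1 →
      law Ω δ (a δ) (b δ) {γ | (⟨γ.walk.toCurve (meshPoint δ)⟩ : Curve ℂ).HasTraversals (k x ρ R) x ρ R}
        ≤ ENNReal.ofReal (K * (ρ / R) ^ lam)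

/-- **Per-shell tightness of the traversal number for the chordal critical SAW** of every Dobrushin domain and
every endpoint approximation (`ShellTightAt D a b`). The rate-free residual of the crux `TPToTraversalBound`;
its content is a Kemppainen–Smirnov Condition-G2 / sub-sequential precompactness statement for the critical
square-lattice SAW (open). Nothing is asserted about it here. -/
def ShellTight : Prop :=
  ∀ (D : DobrushinDomain) (a b : ℝ → Site 2), IsEndpointApprox D a b → ShellTightAt D.carrier a b

/-! ## Per-shell tightness gives (H1) with every exponent -/

variable {Ω : Set ℂ} {a b : ℝ → Site 2}

/-- **One shell.** From per-shell tightness: for every shell `(x, ρ, R)` and every `λ ≥ 0` ONE threshold `kk`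
works at ALL meshes `0 < δ ≤ ρ` (given `ρ < R ≤ 1`): `P_δ(kk separate traversals) ≤ 4^λ (ρ/R)^λ`. Thick shells are
free; for thin ones the tightness threshold at level `(ρ/R)^λ` serves the fine meshes and the lattice capacity of
the box containing `Ω` at the mesh bound serves the coarse ones. -/
theorem exists_threshold_of_shellTightAt (hΩ : Bornology.IsBounded Ω) {lam : ℝ} (hlam : 0 ≤ lam)
    (h : ShellTightAt Ω a b) (x : ℂ) (ρ R : ℝ) :
    ∃ kk : ℕ, ∀ δ : ℝ, 0 < δ → δ ≤ ρ → ρ < R → R ≤ 1 →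
      law Ω δ (a δ) (b δ) {γ | (⟨γ.walk.toCurve (meshPoint δ)⟩ : Curve ℂ).HasTraversals kk x ρ R}
        ≤ ENNReal.ofReal (4 ^ lam * (ρ / R) ^ lam) := by
  obtain ⟨r, hr⟩ := (Metric.isBounded_iff_subset_closedBall (0 : ℂ)).1 hΩ
  by_cases hshell : 0 < ρ ∧ ρ < R ∧ R ≤ 1
  swap
  · exact ⟨0, fun δ hδ hδρ hρR hR1 => (hshell ⟨hδ.trans_le hδρ, hρR, hR1⟩).elim⟩
  obtain ⟨hρ, hρR, hR1⟩ := hshell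
  have hR : 0 < R := hρ.trans hρR
  by_cases hthick : R ≤ 4 * ρ
  · -- thick shell: the bound is at least `1`
    exact ⟨0, fun δ _ _ _ _ => law_le_bound_of_le_mul (C := 4) (by norm_num) hlam hρ hR hthick le_rfl _⟩
  rw [not_le] at hthick
  -- thin shell: tightness at level `(ρ/R)^λ`, capacity cutoff at coarse meshes
  have hε : 0 < (ρ / R) ^ lam := Real.rpow_pos_of_pos (div_pos hρ hR) _
  obtain ⟨k, δ₁, hδ₁, hk⟩ := h x ρ R hρ hρR hR1 _ hε
  refine ⟨max k ((box 2 ⌈r / δ₁⌉₊).card + 1), fun δ hδ hδρ _ _ => ?_⟩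
  have h4 : (1 : ℝ) ≤ 4 ^ lam := Real.one_le_rpow (by norm_num) hlam
  by_cases hfine : δ ≤ δ₁
  · -- fine mesh
    calc law Ω δ (a δ) (b δ) _
        ≤ law Ω δ (a δ) (b δ)
            {γ | (⟨γ.walk.toCurve (meshPoint δ)⟩ : Curve ℂ).HasTraversals k x ρ R} :=
          law_hasTraversals_anti (le_max_left _ _) x ρ R
      _ ≤ ENNReal.ofReal ((ρ / R) ^ lam) := hk δ ⟨hδ, hfine⟩
      _ ≤ ENNReal.ofReal (4 ^ lam * (ρ / R) ^ lam) :=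
          ENNReal.ofReal_le_ofReal (le_mul_of_one_le_left hε.le h4)
  · -- coarse mesh: no SAW has that many separate traversals
    rw [not_le] at hfine
    have hw : 2 * δ < R - ρ := by linarith
    have h0 : law Ω δ (a δ) (b δ)
        {γ | (⟨γ.walk.toCurve (meshPoint δ)⟩ : Curve ℂ).HasTraversals
          (max k ((box 2 ⌈r / δ₁⌉₊).card + 1)) x ρ R} = 0 := by
      refine measure_mono_null (fun γ hγ => ?_) measure_empty
      have hL := le_length_of_hasTraversals hδ.le γ hw
        (Curve.HasTraversals.of_le hγ (le_max_right _ _))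
      have hlt := length_lt_card_box hr hδ₁ hfine.le γ (by omega)
      omega
    exact h0.trans_le zero_le

/-- **Per-shell tightness ⇒ (H1) at `(Ω, a, b)` with every exponent `λ ≥ 0`** (constant `4^λ`, `δ₀ = 1` — in
fact every mesh `0 < δ ≤ ρ` is covered), for any bounded `Ω`. -/
theorem traversalBoundAt_of_shellTightAt (hΩ : Bornology.IsBounded Ω) {lam : ℝ} (hlam : 0 ≤ lam)
    (h : ShellTightAt Ω a b) : TraversalBoundAt Ω a b lam := by
  choose kk hkk using exists_threshold_of_shellTightAt hΩ hlam h
  exact ⟨kk, 4 ^ lam, 1, by positivity, one_pos,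
    fun δ hδ x ρ R hδρ hρR hR1 => hkk x ρ R δ hδ.1 hδρ hρR hR1⟩

/-! ## (H1) with an exponent `> 1` gives per-shell tightness -/

/-- **(H1) at `(Ω, a, b)` with some exponent `λ > 1` ⇒ per-shell tightness at `(Ω, a, b)`.** Net of `M` points on
the middle circle of the shell, pigeonhole with thresholds (`Curve.exists_net_hasTraversals_of_hasTraversals`),
union bound over the `M` small shells at meshes `δ ≤ min(δ₀, w)`, `w = 2πm/M`; `M · K (w/(h-w))^λ → 0`
(`HexTight.ExponentBootstrap.tendsto_unionBound`, reused from the hexagonal twin). -/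
theorem shellTightAt_of_traversalBoundAt {lam : ℝ} (hlam : 1 < lam) (h : TraversalBoundAt Ω a b lam) :
    ShellTightAt Ω a b := by
  classical
  obtain ⟨k, K, δ₀, hK, hδ₀, hb⟩ := h
  intro x ρ R hρ hρR hR1 ε hε
  -- middle radius `m`, half width `hh`
  obtain ⟨m, hm⟩ : ∃ m : ℝ, m = (ρ + R) / 2 := ⟨_, rfl⟩
  obtain ⟨hh, hhh⟩ : ∃ hh : ℝ, hh = (R - ρ) / 2 := ⟨_, rfl⟩
  have hmpos : 0 < m := by rw [hm]; linarith
  have hhpos : 0 < hh := by rw [hhh]; linarith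
  have hh1 : hh ≤ 1 / 2 := by rw [hhh]; linarith
  -- the union-bound constant and the net size
  obtain ⟨C₀, hC₀⟩ : ∃ C₀ : ℝ, C₀ = 4 * Real.pi * m / hh := ⟨_, rfl⟩
  have hC₀pos : 0 < C₀ := by rw [hC₀]; positivity
  obtain ⟨M₀, hM₀⟩ := Filter.eventually_atTop.1
    ((HexTight.ExponentBootstrap.tendsto_unionBound (K := K) hC₀pos.le hlam).eventually
      (Iio_mem_nhds hε))
  obtain ⟨M, hMdef⟩ : ∃ M : ℕ, M = max M₀ (⌈C₀⌉₊ + 1) := ⟨_, rfl⟩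
  have hMM₀ : M₀ ≤ M := hMdef ▸ le_max_left _ _
  have hMC : C₀ < M := by
    have h1 : ((⌈C₀⌉₊ + 1 : ℕ) : ℝ) ≤ M := by rw [hMdef]; exact_mod_cast le_max_right _ _
    have h2 : C₀ < ((⌈C₀⌉₊ + 1 : ℕ) : ℝ) := by
      push_cast; linarith [Nat.le_ceil C₀]
    linarith
  have hMpos : (0 : ℝ) < M := hC₀pos.trans hMC
  have hM1 : 1 ≤ M := by
    rw [hMdef]; exact le_max_of_le_right (Nat.succ_le_succ (Nat.zero_le _))
  have hsmall : (M : ℝ) * (K * (C₀ / M) ^ lam) < ε := hM₀ M hMM₀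
  -- radii of the small shells: `w = 2πm/M`, outer `hh - w`; `2w < hh`
  obtain ⟨w, hw⟩ : ∃ w : ℝ, w = 2 * Real.pi * ((ρ + R) / 2) / M := ⟨_, rfl⟩
  have hw' : w = C₀ * hh / (2 * M) := by
    rw [hw, hC₀, ← hm]; field_simp; ring
  have hwpos : 0 < w := by rw [hw']; positivity
  have h2w : 2 * w < hh := by
    rw [hw', show C₀ * hh / (2 * M) = (C₀ / M) * hh / 2 by field_simp]
    have : C₀ / M < 1 := (div_lt_one hMpos).2 hMC
    nlinarith
  have hratio : w / (hh - w) ≤ C₀ / M := by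
    have hden : hh / 2 ≤ hh - w := by linarith
    calc w / (hh - w) ≤ w / (hh / 2) := div_le_div_of_nonneg_left hwpos.le (by positivity) hden
      _ = C₀ / M := by rw [hw']; field_simp
  -- net centres and the threshold
  obtain ⟨c, hc⟩ : ∃ c : ℕ → ℂ, c = fun j : ℕ => x + (((ρ + R) / 2 : ℝ) : ℂ) *
      Complex.exp (((-Real.pi + 2 * Real.pi * (j : ℝ) / M : ℝ) : ℂ) * Complex.I) := ⟨_, rfl⟩
  refine ⟨∑ j ∈ Finset.range M, k (c j) w (hh - w), min δ₀ w, lt_min hδ₀ hwpos, fun δ hδ => ?_⟩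
  have hδ' : δ ∈ Set.Ioc (0 : ℝ) δ₀ := ⟨hδ.1, hδ.2.trans (min_le_left _ _)⟩
  have hfine : δ ≤ w := hδ.2.trans (min_le_right _ _)
  -- localize on the net
  have hsub : {γ : DomainSAW Ω δ (a δ) (b δ) |
      (⟨γ.walk.toCurve (meshPoint δ)⟩ : Curve ℂ).HasTraversals
        (∑ j ∈ Finset.range M, k (c j) w (hh - w)) x ρ R} ⊆
      ⋃ j ∈ Finset.range M, {γ | (⟨γ.walk.toCurve (meshPoint δ)⟩ : Curve ℂ).HasTraversals
        (k (c j) w (hh - w)) (c j) w (hh - w)} := by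
    intro γ hγ
    obtain ⟨j, hj, hjT⟩ := Curve.exists_net_hasTraversals_of_hasTraversals hρ.le hρR hM1
      (fun j => k (c j) w (hh - w)) hγ
    refine Set.mem_iUnion₂.2 ⟨j, Finset.mem_range.2 hj, ?_⟩
    have e1 : (R - ρ) / 2 - w = hh - w := by rw [hhh]
    rw [← hw] at hjT
    rw [e1] at hjT
    simpa only [hc, Set.mem_setOf_eq] using hjT
  -- union bound
  have hper : ∀ j ∈ Finset.range M,
      law Ω δ (a δ) (b δ) {γ | (⟨γ.walk.toCurve (meshPoint δ)⟩ : Curve ℂ).HasTraversals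
        (k (c j) w (hh - w)) (c j) w (hh - w)} ≤ ENNReal.ofReal (K * (C₀ / M) ^ lam) := by
    intro j _
    refine (hb δ hδ' (c j) w (hh - w) hfine (by linarith) (by linarith)).trans
      (ENNReal.ofReal_le_ofReal (mul_le_mul_of_nonneg_left ?_ hK))
    exact Real.rpow_le_rpow (div_nonneg hwpos.le (by linarith)) hratio (by linarith)
  calc law Ω δ (a δ) (b δ) _
      ≤ law Ω δ (a δ) (b δ) (⋃ j ∈ Finset.range M, {γ |
          (⟨γ.walk.toCurve (meshPoint δ)⟩ : Curve ℂ).HasTraversals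
            (k (c j) w (hh - w)) (c j) w (hh - w)}) := measure_mono hsub
    _ ≤ ∑ j ∈ Finset.range M, law Ω δ (a δ) (b δ) {γ |
          (⟨γ.walk.toCurve (meshPoint δ)⟩ : Curve ℂ).HasTraversals
            (k (c j) w (hh - w)) (c j) w (hh - w)} := measure_biUnion_finset_le _ _
    _ ≤ ∑ j ∈ Finset.range M, ENNReal.ofReal (K * (C₀ / M) ^ lam) := Finset.sum_le_sum hper
    _ = ENNReal.ofReal ((M : ℝ) * (K * (C₀ / M) ^ lam)) := by
        rw [Finset.sum_const, Finset.card_range, nsmul_eq_mul, ← ENNReal.ofReal_natCast M,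
          ← ENNReal.ofReal_mul (Nat.cast_nonneg M)]
    _ ≤ ENNReal.ofReal ε := ENNReal.ofReal_le_ofReal hsmall.le

/-! ## The equivalences -/

/-- **`ShellTight → SAWTraversalBound`** (exponent `3`, constant `64`, `δ₀ = 1`). -/
theorem traversalBound_of_shellTight (h : ShellTight) : SAWTraversalBound := by
  intro D a b hab
  obtain ⟨k, K, δ₀, hK, hδ₀, hb⟩ :=
    traversalBoundAt_of_shellTightAt D.isBounded (lam := 3) (by norm_num) (h D a b hab)
  exact ⟨k, K, 3, δ₀, hK, by norm_num, hδ₀, hb⟩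

/-- **`SAWTraversalBound → ShellTight`** (only `λ > 1` of (H1) is used). -/
theorem shellTight_of_traversalBound (h : SAWTraversalBound) : ShellTight := by
  intro D a b hab
  obtain ⟨k, K, lam, δ₀, hK, hlam, hδ₀, hb⟩ := h D a b hab
  exact shellTightAt_of_traversalBoundAt (lam := lam) (by linarith) ⟨k, K, δ₀, hK, hδ₀, hb⟩

/-- **The Aizenman–Burchard hypothesis (H1) for the critical square-lattice SAW IS per-shell tightness of the
traversal number.** -/
theorem shellTight_iff_traversalBound : ShellTight ↔ SAWTraversalBound :=
  ⟨traversalBound_of_shellTight, shellTight_of_traversalBound⟩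

/-- **The crux in rate-free form**: `TPToTraversalBound ↔ (BoundaryTP2 → CriticalBubbleBound → ShellTight)`. -/
theorem tpToTraversalBound_iff_shellTight :
    TPToTraversalBound ↔ (BoundaryTP2 → CriticalBubbleBound → ShellTight) :=
  ⟨fun h hTP hB => shellTight_iff_traversalBound.2 (h hTP hB),
    fun h hTP hB => shellTight_iff_traversalBound.1 (h hTP hB)⟩

/-- **Rev-5 composition of the line**: the single residual stub `BoundaryTP2 → CriticalBubbleBound → ShellTight`
gives the crux BY NAME. -/
theorem tpToTraversalBound_of_shellTight (h : BoundaryTP2 → CriticalBubbleBound → ShellTight) :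
    TPToTraversalBound :=
  tpToTraversalBound_iff_shellTight.2 h

end Summit.CriticalPhenomena.SAWScalingLimit.Theorems.TPToTraversalBound.Radial

end
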